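import Summits.QuantumFields.BalabanUV.T4Continuum.Spine.NE1p.DressedUniformConstantsOf

/-!
# T⁴ programme, spine estimate NE1′ (node O3b/H2) — THE NECESSITY SIDE OF LEAF S3: what the cell's (w7) ∕ (w6) FORCE, in kernel
# (located costs of the dressed format's arithmetic; companion of `Spine/NE1p/DressedUniformConstants.lean`)

Cell `pub-balaban`, sub-cell `t4`, BINDER-OWNERS row NE1′, formalisation crew `b2b-balaban-t4-ne1p-formalise-*`, seat
`…-leaf-07` (gen 2; own-initiative SUPPLIER ∕ LOCATED-COST item «S3c» under row S3's scope in `t4/formal/NE1p/LEAVES.md`,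
journal `CLAIMS.log` INTENT NE1p-S3c l.9112; row holder leaf-09: «GO» l.9247).  ADDITIVE — imports `Spine/NE1p/DressedUniformConstantsOf`
(row S3-sup, p213131; it imports row S3 `DressedUniformConstants` p212599) ONLY, modifies nothing; THEOREMS ONLY (no `def`, no `def … : Prop`).

WHY THIS FILE.  Leaf S3 (`DressedUniformConstants`) decides the cell's arithmetic ONCE, in the SUFFICIENCY direction: from the
displayed binders `locCell L C c̄ κ ≤ ρ′ < 1` ((w7), the located largeness `e³(1+4κ)∕L + L·C·c̄`) and the window (w6) it BUILDS the
K-∕μ-free `U : UniformConstants` that END-B `DressedRoot.dressedStability_of_bookingLeaves` consumes, with an explicit largeness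
binder `LzeroCell κ η ≤ L` and NO numeral taken from print (trigger caveat k2: Bałaban's `L` is «a fixed large integer»; the owner's
located risk R2 reads «L > e³(1+o(1)) ≈ 20.1»).  This file is the CONVERSE bookkeeping — what any instantiation of those binder
SHAPES must pay — so that the cell's smallness census carries NUMBERS derived in kernel rather than adjectives:

* §1 KERNEL ENCLOSURE `20.08 < e³ < 20.09` (`exp_three_gt_20_08`, `exp_three_lt_20_09`) from Mathlib's nine-digit bounds
  `Real.exp_one_gt_d9` ∕ `Real.exp_one_lt_d9` (engine 1 = the Lean kernel; engine 2 = a 50-digit decimal series summation,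
  `e³ = 20.0855369231876677409…`, recorded in the seat's census note — two engines agree; S3 v1 carries only `e³ < 20.5`).
* §2 NECESSITY OF THE LOCATED LARGENESS AND OF THE REGENERATION SMALLNESS: `0 < L`, signs, `locCell L C c̄ κ ≤ ρ′ < 1` ⟹
  `alphaCell κ = e³(1+4κ) < L` AND `L·C·c̄ < 1` (`necessity_of_cell`), hence `e³ < L`, `20.08 < L`, the ratio ceiling
  `κ < (L∕e³ − 1)∕4`, and the exact reading of (w7) in the cell's numbers: `locCell = L·ρ₁` (`locCell_eq_mul_rhoOne`), i.e. the
  family factor must satisfy `ρ₁ ≤ ρ′∕L < 1∕L` — the booked sizes of a family shrink by MORE THAN THE BLOCK SIZE per step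
  (`rhoOne_lt_inv_of_cell`; for the constructor: `uniformConstantsCell_ρ₁_lt_inv`).
* §3 THE INTEGER THRESHOLD, SHARP: for an integer block size `L ≥ 1` the binder family of `uniformConstantsCell`'s (w7) is
  inhabited for SOME `(C, c̄, κ, ρ′)` IFF `21 ≤ L` (`cell_inhabited_iff`: `20` fails for every `κ, C, c̄ ≥ 0`; `21` is inhabited at
  `κ = c̄ = 0`, `ρ′ = 24∕25`); with the two ratio bounds that occur in the crew's files the thresholds are `κ = 1∕4 ⟹ 41 ≤ L`
  (`fortyOne_le_of_cell_quarter`, sharp — `41` is exactly leaf-09's numeral witness) and `κ = 2` (the `ratioGeometric` schedule of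
  S1's XREAD X3 INFO-2) `⟹ 181 ≤ L` (`oneEightyOne_le_of_cell_two`, sharp).
* §3b THE SAME FOR A GENERAL K-FREE STEP FACTOR (row S3-sup's `locOf L a C c̄ = a∕L + L·C·c̄`, p213131): `locOf ≤ ρ′ < 1`, `0 < L` ⟹
  `a < L ∧ L·C·c̄ < 1` (`necessity_of_stepFactor`); at the q-scaled factor `a = alphaCell κ∕q` of the (R-a) repair (leaf-08
  F-ne1pleaf08-1 (5), `LzeroOf_div`): `e³(1+4κ) < q·L` (`exp_three_mul_lt_of_stepFactor_div`) — for `q = 1∕2`, `κ = 0` the integer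
  block size is `≥ 41` (`fortyOne_le_of_halfRate`, sharp: `locOf_fortyOne_halfRate_le`), the docstring arithmetic «2e³ ≈ 40.2» of
  S3-sup as a kernel threshold.
* §4 (w6) ⟹ THE NUMBER: for EVERY `U : UniformConstants`, `U.sbar ≤ 1` (`sbar_le_one`), and a live source `0 < U.m·U.N₀·U.A₀`
  FORCES `U.sbar < 1` (`sbar_lt_one_of_source_pos`) — the wall (w2-act) «s̄⁰ < 1» is already inside END-B's constants through the
  (w6) field; the source window is EXACT: `0 < muWindow … ↔ s̄⁰ < 1` (`muWindow_pos_iff`) and (w6) `↔ μ₀ ≤ muWindow …`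
  (`hsmall_iff_le_muWindow`, converse of S3's `hsmall_of_le_muWindow`); per cutoff, along any trajectory booked by
  `BookingLeaves U Bk T`, every live family's action margin plus its met component's source share is `≤ 1` at every step `< K`
  (`margin_add_source_le_one` — the dressed gate read back out of `classAt_of_bookingLeaves`).

HONEST FRAMING.  These are located costs of the CELL's bookkeeping shapes (`locCell`, `muWindow`, `UniformConstants.hsmall`),
NOT statements about Bałaban's `L` or his densities: the numerals 21 ∕ 41 ∕ 181 are CONSEQUENCES of S3's `locCell`, derived in
kernel, never cited from print (k2 respected — no printed lower bound on `L` exists or is claimed).  [folklore]-free: our own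
arithmetic; 0 sorry; 0 citations used as facts.  Every headline reads «cost ⇐ the cell's displayed binders»; NE1′ ⇐ the named
binders, NOT proved; the wall of record (w1), (w2-act) THE NUMBER, (w3)⁺, (w5), F-6's rate stands DISPLAYED; 0 leaves instantiated
on Bałaban's densities; spine PROVED 0∕9.  Rung (B)+1 on ONE finite four-torus — NOT infinite volume, NOT a mass gap, NOT OS on
ℝ⁴, NOT Clay.  HONEST DEPENDENCY: continuum YM on T⁴ ⇐ BetaPertH ∧ nine spine estimates (0/9 proved); BetaPertH ⇐ (D1) ∧ (D4) ∧
CAP+tail; G-an2-4 gates asym, D1 and NE2/3/4.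
-/

noncomputable section

namespace Summit.QuantumFields.BalabanUV.T4Continuum.NE1p.DressedCellNecessity

open Finset
open scoped BigOperators
open Literature.MathematicalPhysics.QuantumFieldTheory.Balaban1983to89
open Literature.MathematicalPhysics.QuantumFieldTheory.Balaban1983to89.T4TermFormat
open Literature.MathematicalPhysics.QuantumFieldTheory.Balaban1983to89.T4TrajectoryComparison
open Summit.QuantumFields.BalabanUV.T4Continuum.T4TrajectoryDensityDressed
open Summit.QuantumFields.BalabanUV.T4Continuum.NE1p.DressedRoot
open Summit.QuantumFields.BalabanUV.T4Continuum.NE1p.DressedUniformConstants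

/-! ## §1 Kernel enclosure of `e³` -/

/-- `e³ = (e¹)³`. [arith] -/
theorem exp_three_eq_cube : Real.exp 3 = Real.exp 1 ^ 3 := by
  rw [← Real.exp_nat_mul]; norm_num

/-- **LOWER ENCLOSURE** [decided numeral]: `20.08 < e³` (from `2.7182818283 < e`, Mathlib `Real.exp_one_gt_d9`;
`2.7182818283³ = 20.08553691966…`).  Engine 2 (50-digit decimal series): `e³ = 20.08553692318766774092852965…`.  (The weaker
`20 < e³` is already in the tree as `Literature.NumberTheory.Sieve.exp_three_gt`; not imported here to keep the closure QFT-only.) -/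
theorem exp_three_gt_20_08 : (20.08 : ℝ) < Real.exp 3 := by
  rw [exp_three_eq_cube]
  have hcube : (2.7182818283 : ℝ) ^ 3 < Real.exp 1 ^ 3 :=
    pow_lt_pow_left₀ Real.exp_one_gt_d9 (by norm_num) three_ne_zero
  have hnum : (20.08 : ℝ) < (2.7182818283 : ℝ) ^ 3 := by norm_num
  exact hnum.trans hcube

/-- **UPPER ENCLOSURE** [decided numeral]: `e³ < 20.09` (from `e < 2.7182818286`, Mathlib `Real.exp_one_lt_d9`;
`2.7182818286³ = 20.08553692631…`; sharpens S3's `exp_three_lt : e³ < 20.5`). -/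
theorem exp_three_lt_20_09 : Real.exp 3 < 20.09 := by
  rw [exp_three_eq_cube]
  have hcube : Real.exp 1 ^ 3 < (2.7182818286 : ℝ) ^ 3 :=
    pow_lt_pow_left₀ Real.exp_one_lt_d9 (Real.exp_pos 1).le three_ne_zero
  have hnum : (2.7182818286 : ℝ) ^ 3 < (20.09 : ℝ) := by norm_num
  exact hcube.trans hnum

/-- The uniform step factor is above `20.08·(1+4κ)`: `20.08·(1 + 4κ) < alphaCell κ` for `κ ≥ 0`. [arith] -/
theorem lower_mul_lt_alphaCell {κ : ℝ} (hκ : 0 ≤ κ) : 20.08 * (1 + 4 * κ) < alphaCell κ := by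
  unfold alphaCell
  exact mul_lt_mul_of_pos_right exp_three_gt_20_08 (by linarith)

/-! ## §2 Necessity of the located largeness and of the regeneration smallness -/

/-- **NECESSITY** [arith]: if the located quantity is below one, `locCell L C c̄ κ < 1`, for a positive block size and nonnegative
`C, c̄, κ`, then BOTH the largeness `alphaCell κ = e³(1+4κ) < L` AND the regeneration smallness `L·C·c̄ < 1` hold — neither half
of (w7) can be traded against the other beyond these ceilings. -/
theorem necessity_of_locCell_lt_one {L C cbar κ : ℝ} (hL : 0 < L) (hC : 0 ≤ C) (hcbar : 0 ≤ cbar) (hκ : 0 ≤ κ)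
    (h : locCell L C cbar κ < 1) : alphaCell κ < L ∧ L * C * cbar < 1 := by
  unfold locCell at h
  have hα : 0 < alphaCell κ := alphaCell_pos hκ
  have hreg : 0 ≤ L * C * cbar := by positivity
  have hdiv : 0 < alphaCell κ / L := div_pos hα hL
  refine ⟨?_, by linarith⟩
  have h1 : alphaCell κ / L < 1 := by linarith
  rwa [div_lt_one hL] at h1

/-- **NECESSITY IN THE BINDER SHAPE OF `uniformConstantsCell`** [arith]: the constructor's binders `hloc : locCell L C c̄ κ ≤ ρ′` and
`hρ′1 : ρ′ < 1` (with `0 < L` and the signs) force `e³(1+4κ) < L` and `L·C·c̄ < 1`. -/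
theorem necessity_of_cell {L C cbar κ ρ' : ℝ} (hL : 0 < L) (hC : 0 ≤ C) (hcbar : 0 ≤ cbar) (hκ : 0 ≤ κ)
    (hloc : locCell L C cbar κ ≤ ρ') (hρ'1 : ρ' < 1) : alphaCell κ < L ∧ L * C * cbar < 1 :=
  necessity_of_locCell_lt_one hL hC hcbar hκ (hloc.trans_lt hρ'1)

/-- **THE LARGENESS IS NECESSARY** [arith]: `e³·(1 + 4κ) < L`. -/
theorem exp_three_mul_lt_of_cell {L C cbar κ ρ' : ℝ} (hL : 0 < L) (hC : 0 ≤ C) (hcbar : 0 ≤ cbar) (hκ : 0 ≤ κ)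
    (hloc : locCell L C cbar κ ≤ ρ') (hρ'1 : ρ' < 1) : Real.exp 3 * (1 + 4 * κ) < L :=
  (necessity_of_cell hL hC hcbar hκ hloc hρ'1).1

/-- In particular `e³ < L`: the owner's located risk R2 ∕ trigger caveat k2 «L > e³(1+o(1))» as a kernel inequality on the
cell's shapes (NOT a statement about Bałaban's `L`). [arith] -/
theorem exp_three_lt_of_cell {L C cbar κ ρ' : ℝ} (hL : 0 < L) (hC : 0 ≤ C) (hcbar : 0 ≤ cbar) (hκ : 0 ≤ κ)
    (hloc : locCell L C cbar κ ≤ ρ') (hρ'1 : ρ' < 1) : Real.exp 3 < L :=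
  lt_of_le_of_lt (exp_three_le_alphaCell hκ) (necessity_of_cell hL hC hcbar hκ hloc hρ'1).1

/-- … hence `20.08 < L` (§1), in particular `20 < L`. [decided numeral] -/
theorem lower_lt_of_cell {L C cbar κ ρ' : ℝ} (hL : 0 < L) (hC : 0 ≤ C) (hcbar : 0 ≤ cbar) (hκ : 0 ≤ κ)
    (hloc : locCell L C cbar κ ≤ ρ') (hρ'1 : ρ' < 1) : (20.08 : ℝ) < L :=
  exp_three_gt_20_08.trans (exp_three_lt_of_cell hL hC hcbar hκ hloc hρ'1)

/-- **THE REGENERATION SMALLNESS IS NECESSARY** [arith]: `L·C·c̄ < 1 − e³(1+4κ)∕L < 1` — the K-free regeneration bound `c̄`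
((w5), displayed) must be small against `L·C`, with the transport part already spent. -/
theorem reg_lt_of_cell {L C cbar κ ρ' : ℝ} (hloc : locCell L C cbar κ ≤ ρ') (hρ'1 : ρ' < 1) :
    L * C * cbar < 1 - alphaCell κ / L := by
  unfold locCell at hloc
  linarith

/-- **THE RATIO CEILING** [arith]: the K-free diameter∕radius ratio bound `κ` of (w4) is capped by the block size,
`κ < (L∕e³ − 1)∕4`. -/
theorem kappa_lt_of_cell {L C cbar κ ρ' : ℝ} (hL : 0 < L) (hC : 0 ≤ C) (hcbar : 0 ≤ cbar) (hκ : 0 ≤ κ)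
    (hloc : locCell L C cbar κ ≤ ρ') (hρ'1 : ρ' < 1) : κ < (L / Real.exp 3 - 1) / 4 := by
  have h := exp_three_mul_lt_of_cell hL hC hcbar hκ hloc hρ'1
  have he : 0 < Real.exp 3 := Real.exp_pos 3
  have h1 : 1 + 4 * κ < L / Real.exp 3 := by
    rw [lt_div_iff₀ he]
    linarith
  linarith

/-- **THE EXACT READING OF (w7) IN THE CELL's NUMBERS** [arith]: `locCell L C c̄ κ = L · rhoOne L⁻² C c̄ κ` (`Λ·τ = L⁴·L⁻³ = L`),
so `locCell ≤ ρ′` says precisely `ρ₁ ≤ ρ′∕L`. -/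
theorem locCell_eq_mul_rhoOne {L C cbar κ : ℝ} (hL : L ≠ 0) :
    locCell L C cbar κ = L * rhoOne (L ^ 2)⁻¹ C cbar κ := by
  unfold locCell rhoOne
  field_simp

/-- (w7) ⟺ the family factor is at most `ρ′∕L`. [arith] -/
theorem locCell_le_iff_rhoOne_le {L C cbar κ ρ' : ℝ} (hL : 0 < L) :
    locCell L C cbar κ ≤ ρ' ↔ rhoOne (L ^ 2)⁻¹ C cbar κ ≤ ρ' / L := by
  rw [locCell_eq_mul_rhoOne hL.ne', le_div_iff₀ hL, mul_comm]

/-- **THE FAMILY FACTOR MUST BEAT THE BLOCK SIZE** [arith]: under the cell's (w7), `ρ₁ = rhoOne L⁻² C c̄ κ < L⁻¹` — a family's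
booked sizes shrink by more than a factor `L` per step. -/
theorem rhoOne_lt_inv_of_cell {L C cbar κ ρ' : ℝ} (hL : 0 < L) (hloc : locCell L C cbar κ ≤ ρ') (hρ'1 : ρ' < 1) :
    rhoOne (L ^ 2)⁻¹ C cbar κ < L⁻¹ := by
  have h : rhoOne (L ^ 2)⁻¹ C cbar κ ≤ ρ' / L := (locCell_le_iff_rhoOne_le hL).mp hloc
  have h2 : ρ' / L < L⁻¹ := by
    rw [div_lt_iff₀ hL, inv_mul_cancel₀ hL.ne']
    exact hρ'1
  exact h.trans_lt h2

/-- The same for the constructor's field: `(uniformConstantsCell L …).ρ₁ < L⁻¹`. [arith] -/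
theorem uniformConstantsCell_ρ₁_lt_inv {L C cbar κ N₀ A₀ m sbar ρ' : ℝ} (hL : 1 ≤ L) (hC : 0 ≤ C) (hcbar : 0 ≤ cbar)
    (hκ : 0 ≤ κ) (hN₀ : 0 ≤ N₀) (hA₀ : 0 ≤ A₀) (hm : 0 ≤ m) (hloc : locCell L C cbar κ ≤ ρ') (hρ'1 : ρ' < 1)
    (hsmall : m * (N₀ * A₀ * (1 - ρ')⁻¹) ≤ 1 - sbar) :
    (uniformConstantsCell L C cbar κ N₀ A₀ m sbar ρ' hL hC hcbar hκ hN₀ hA₀ hm hloc hρ'1 hsmall).ρ₁ < L⁻¹ := by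
  rw [uniformConstantsCell_ρ₁]
  exact rhoOne_lt_inv_of_cell (by linarith) hloc hρ'1

/-! ## §3 The integer threshold (sharp) and the two named ratio ceilings -/

/-- **NECESSITY FOR AN INTEGER BLOCK SIZE** [decided numeral]: `21 ≤ L`. -/
theorem twentyOne_le_of_cell {L : ℕ} {C cbar κ ρ' : ℝ} (hL : 0 < L) (hC : 0 ≤ C) (hcbar : 0 ≤ cbar) (hκ : 0 ≤ κ)
    (hloc : locCell (L : ℝ) C cbar κ ≤ ρ') (hρ'1 : ρ' < 1) : 21 ≤ L := by
  have h20 : (20 : ℝ) < (L : ℝ) := by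
    have := lower_lt_of_cell (Nat.cast_pos.mpr hL) hC hcbar hκ hloc hρ'1
    linarith
  have : (20 : ℕ) < L := by exact_mod_cast h20
  omega

/-- `L = 20` FAILS for every `κ, C, c̄ ≥ 0`: `1 < locCell 20 C c̄ κ`. [decided numeral] -/
theorem one_lt_locCell_twenty {C cbar κ : ℝ} (hC : 0 ≤ C) (hcbar : 0 ≤ cbar) (hκ : 0 ≤ κ) :
    1 < locCell 20 C cbar κ := by
  unfold locCell
  have hα' : 20.08 * (1 + 4 * κ) < alphaCell κ := lower_mul_lt_alphaCell hκ
  have hα : 20 * (1 + 4 * κ) < alphaCell κ :=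
    lt_of_le_of_lt (mul_le_mul_of_nonneg_right (by norm_num) (by linarith)) hα'
  have hreg : 0 ≤ 20 * C * cbar := by positivity
  have h1 : 1 < alphaCell κ / 20 := by
    rw [lt_div_iff₀ (by norm_num : (0:ℝ) < 20)]
    nlinarith
  linarith

/-- The transport part at `κ = c̄ = 0` is antitone in the block size: `locCell L C 0 0 = e³∕L ≤ e³∕L₀` for `0 < L₀ ≤ L`. [arith] -/
theorem locCell_zero_antitone {L L₀ C : ℝ} (hL₀ : 0 < L₀) (h : L₀ ≤ L) : locCell L C 0 0 ≤ Real.exp 3 / L₀ := by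
  unfold locCell alphaCell
  simp only [mul_zero, add_zero, mul_one]
  exact div_le_div_of_nonneg_left (Real.exp_pos 3).le hL₀ h

/-- `L = 21` — and every integer block size `L ≥ 21` — IS INHABITED at `κ = c̄ = 0`: `locCell L C 0 0 = e³∕L ≤ e³∕21 ≤ 24∕25 < 1`
(take `ρ′ = 24∕25`). [decided numeral] -/
theorem locCell_le_of_twentyOne_le {L : ℕ} (hL : 21 ≤ L) {C : ℝ} : locCell (L : ℝ) C 0 0 ≤ 24 / 25 := by
  have hcast : (21 : ℝ) ≤ (L : ℝ) := by exact_mod_cast hL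
  have h := locCell_zero_antitone (C := C) (by norm_num : (0:ℝ) < 21) hcast
  have h2 : Real.exp 3 / 21 ≤ 24 / 25 := by
    rw [div_le_iff₀ (by norm_num : (0:ℝ) < 21)]
    have := exp_three_lt_20_09
    linarith
  exact h.trans h2

/-- **THE THRESHOLD IS EXACTLY 21** [decided numeral]: for an integer block size `L ≥ 1`, the (w7) binder family of
`uniformConstantsCell` — SOME nonnegative `C, c̄, κ` and SOME `ρ′` with `locCell L C c̄ κ ≤ ρ′ < 1` — is inhabited iff `21 ≤ L`.
(For `L = 0` Lean's `x∕0 = 0` makes `locCell` vanish; the constructor itself requires `1 ≤ L`.) -/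
theorem cell_inhabited_iff {L : ℕ} (hL : 0 < L) :
    (∃ C cbar κ ρ' : ℝ, 0 ≤ C ∧ 0 ≤ cbar ∧ 0 ≤ κ ∧ locCell (L : ℝ) C cbar κ ≤ ρ' ∧ ρ' < 1) ↔ 21 ≤ L := by
  constructor
  · rintro ⟨C, cbar, κ, ρ', hC, hcbar, hκ, hloc, hρ'1⟩
    exact twentyOne_le_of_cell hL hC hcbar hκ hloc hρ'1
  · intro h21
    exact ⟨0, 0, 0, 24 / 25, le_rfl, le_rfl, le_rfl, locCell_le_of_twentyOne_le h21, by norm_num⟩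

/-- **RATIO `κ = 1∕4` (fluctuation diameter ≤ a quarter of the chart radius) ⟹ `41 ≤ L`** [decided numeral]
(`alphaCell (1∕4) = 2e³ = 40.171…`). -/
theorem fortyOne_le_of_cell_quarter {L : ℕ} {C cbar ρ' : ℝ} (hL : 0 < L) (hC : 0 ≤ C) (hcbar : 0 ≤ cbar)
    (hloc : locCell (L : ℝ) C cbar (1 / 4) ≤ ρ') (hρ'1 : ρ' < 1) : 41 ≤ L := by
  have h := exp_three_mul_lt_of_cell (Nat.cast_pos.mpr hL) hC hcbar (by norm_num) hloc hρ'1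
  have h40 : (40 : ℝ) < (L : ℝ) := by
    have := exp_three_gt_20_08
    linarith
  have : (40 : ℕ) < L := by exact_mod_cast h40
  omega

/-- … and `L = 41` is inhabited at `κ = 1∕4`, `c̄ = 0`: `locCell 41 C 0 (1∕4) = 2e³∕41 ≤ 49∕50`. SHARP. [decided numeral] -/
theorem locCell_fortyOne_quarter_le {C : ℝ} : locCell 41 C 0 (1 / 4) ≤ 49 / 50 := by
  unfold locCell alphaCell
  simp only [mul_zero, add_zero]
  rw [div_le_iff₀ (by norm_num : (0:ℝ) < 41)]
  have := exp_three_lt_20_09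
  linarith

/-- **RATIO `κ = 2` (the `ratioGeometric` schedule of row S1's XREAD X3 INFO-2) ⟹ `181 ≤ L`** [decided numeral]
(`alphaCell 2 = 9e³ = 180.77…`). -/
theorem oneEightyOne_le_of_cell_two {L : ℕ} {C cbar ρ' : ℝ} (hL : 0 < L) (hC : 0 ≤ C) (hcbar : 0 ≤ cbar)
    (hloc : locCell (L : ℝ) C cbar 2 ≤ ρ') (hρ'1 : ρ' < 1) : 181 ≤ L := by
  have h := exp_three_mul_lt_of_cell (Nat.cast_pos.mpr hL) hC hcbar (by norm_num) hloc hρ'1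
  have h180 : (180 : ℝ) < (L : ℝ) := by
    have := exp_three_gt_20_08
    linarith
  have : (180 : ℕ) < L := by exact_mod_cast h180
  omega

/-- … and `L = 181` is inhabited at `κ = 2`, `c̄ = 0`: `locCell 181 C 0 2 = 9e³∕181 ≤ 999∕1000`. SHARP. [decided numeral] -/
theorem locCell_oneEightyOne_two_le {C : ℝ} : locCell 181 C 0 2 ≤ 999 / 1000 := by
  unfold locCell alphaCell
  simp only [mul_zero, add_zero]
  rw [div_le_iff₀ (by norm_num : (0:ℝ) < 181)]
  have := exp_three_lt_20_09
  linarith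

/-! ## §3b The same necessity for a general K-free step factor (row S3-sup's `locOf`) -/

/-- **NECESSITY FOR A GENERAL STEP FACTOR** [arith]: `locOf L a C c̄ < 1` with `0 < L`, `a, C, c̄ ≥ 0` forces `a < L` AND `L·C·c̄ < 1`. -/
theorem necessity_of_locOf_lt_one {L a C cbar : ℝ} (hL : 0 < L) (ha : 0 ≤ a) (hC : 0 ≤ C) (hcbar : 0 ≤ cbar)
    (h : locOf L a C cbar < 1) : a < L ∧ L * C * cbar < 1 := by
  unfold locOf at h
  have hreg : 0 ≤ L * C * cbar := by positivity
  have hdiv : 0 ≤ a / L := div_nonneg ha hL.le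
  refine ⟨?_, by linarith⟩
  have h1 : a / L < 1 := by linarith
  rwa [div_lt_one hL] at h1

/-- **NECESSITY IN THE BINDER SHAPE OF `uniformConstantsOf`** [arith]: `hloc : locOf L a C c̄ ≤ ρ′`, `hρ′1 : ρ′ < 1`, `0 < L` and the
signs force `a < L` and `L·C·c̄ < 1` — the step factor of the rate `ψ·a` must be below the block size. -/
theorem necessity_of_stepFactor {L a C cbar ρ' : ℝ} (hL : 0 < L) (ha : 0 ≤ a) (hC : 0 ≤ C) (hcbar : 0 ≤ cbar)
    (hloc : locOf L a C cbar ≤ ρ') (hρ'1 : ρ' < 1) : a < L ∧ L * C * cbar < 1 :=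
  necessity_of_locOf_lt_one hL ha hC hcbar (hloc.trans_lt hρ'1)

/-- **THE q-SCALED LARGENESS IS NECESSARY** [arith]: at the step factor `a = alphaCell κ ∕ q` of the rate `ψ·α∕q` (repair (R-a),
`DressedUniformConstants.LzeroOf_div`), (w7) forces `e³·(1 + 4κ) < q·L`. -/
theorem exp_three_mul_lt_of_stepFactor_div {L q C cbar κ ρ' : ℝ} (hL : 0 < L) (hq : 0 < q) (hC : 0 ≤ C)
    (hcbar : 0 ≤ cbar) (hκ : 0 ≤ κ) (hloc : locOf L (alphaCell κ / q) C cbar ≤ ρ') (hρ'1 : ρ' < 1) :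
    Real.exp 3 * (1 + 4 * κ) < q * L := by
  have ha : 0 ≤ alphaCell κ / q := div_nonneg (alphaCell_nonneg hκ) hq.le
  have h := (necessity_of_stepFactor hL ha hC hcbar hloc hρ'1).1
  rw [div_lt_iff₀ hq] at h
  unfold alphaCell at h
  linarith [mul_comm L q]

/-- **HALF RATE (`q = 1∕2`, `κ = 0`; S3-sup's docstring arithmetic «L > 2e³ ≈ 40.2») ⟹ `41 ≤ L`** [decided numeral] — the same integer
threshold as the ratio `κ = 1∕4` at `q = 1` (`alphaCell (1∕4) = 2·alphaCell 0`). -/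
theorem fortyOne_le_of_halfRate {L : ℕ} {C cbar ρ' : ℝ} (hL : 0 < L) (hC : 0 ≤ C) (hcbar : 0 ≤ cbar)
    (hloc : locOf (L : ℝ) (alphaCell 0 / (1 / 2)) C cbar ≤ ρ') (hρ'1 : ρ' < 1) : 41 ≤ L := by
  have h := exp_three_mul_lt_of_stepFactor_div (Nat.cast_pos.mpr hL) (by norm_num) hC hcbar le_rfl hloc hρ'1
  have h40 : (40 : ℝ) < (L : ℝ) := by
    have := exp_three_gt_20_08
    norm_num at h
    linarith
  have : (40 : ℕ) < L := by exact_mod_cast h40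
  omega

/-- … and `L = 41` is inhabited at the half rate, `κ = c̄ = 0`: `locOf 41 (alphaCell 0 ∕ (1∕2)) C 0 = 2e³∕41 ≤ 49∕50`. SHARP.
[decided numeral] -/
theorem locOf_fortyOne_halfRate_le {C : ℝ} : locOf 41 (alphaCell 0 / (1 / 2)) C 0 ≤ 49 / 50 := by
  unfold locOf alphaCell
  simp only [mul_zero, add_zero, mul_one]
  rw [div_div, div_le_iff₀ (by norm_num : (0:ℝ) < 1 / 2 * 41)]
  have := exp_three_lt_20_09
  linarith

/-! ## §4 (w6) ⟹ THE NUMBER, and the source window is exact -/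

/-- **(w6) BOUNDS THE ACTION MARGIN BY ONE** [arith]: for every `U : UniformConstants`, `U.sbar ≤ 1` — the source term of the
(w6) field is nonnegative. -/
theorem sbar_le_one (U : UniformConstants) : U.sbar ≤ 1 := by
  have h1 : 0 < 1 - U.ρ' := by linarith [U.hρ'1]
  have hm := U.hm; have hN := U.hN₀; have hA := U.hA₀
  have : 0 ≤ U.m * (U.N₀ * U.A₀ * (1 - U.ρ')⁻¹) := by positivity
  linarith [U.hsmall]

/-- **A LIVE SOURCE FORCES THE NUMBER** [arith]: if the dressed budget carries any source at all, `0 < U.m·U.N₀·U.A₀`, then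
`U.sbar < 1` — the wall (w2-act) «s̄⁰ < 1» (the per-step ACTION oscillation margin, asserted for Bałaban's densities nowhere) is a
CONSEQUENCE of the (w6) field of END-B's constants: no `UniformConstants` with a live source exists unless THE NUMBER holds. -/
theorem sbar_lt_one_of_source_pos (U : UniformConstants) (h : 0 < U.m * U.N₀ * U.A₀) : U.sbar < 1 := by
  have h1 : 0 < 1 - U.ρ' := by linarith [U.hρ'1]
  have hpos : 0 < U.m * (U.N₀ * U.A₀ * (1 - U.ρ')⁻¹) := by
    have : U.m * (U.N₀ * U.A₀ * (1 - U.ρ')⁻¹) = U.m * U.N₀ * U.A₀ * (1 - U.ρ')⁻¹ := by ring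
    rw [this]
    exact mul_pos h (inv_pos.mpr h1)
  linarith [U.hsmall]

/-- **THE DRESSED GATE READ BACK** [bookkeeping]: along any trajectory booked by `BookingLeaves U Bk T`, at every step `i < K` and for
every family `b` born by then, the action margin plus the met component's source share is within the unit budget:
`s⁰ b i + m·Σ_{f ∈ S i b} envVar C ρ f i ≤ 1` — `classAt_of_bookingLeaves` gives `RanBelow (budgetGate …) K`.  This is the per-step
form in which THE NUMBER enters: the margin must leave room for the live sources of the component. -/
theorem margin_add_source_le_one {U : UniformConstants} {Bk : T4TermFormat.Booking} {T : Trajectory Bk}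
    (Lv : BookingLeaves U Bk T) {i : ℕ} (hi : i < Bk.K) (b : Bk.Birth) (hb : Bk.birthScale b ≤ i) :
    Lv.s₀ b i + U.m * ∑ f ∈ Lv.S i b, T.envVar U.C Lv.ρ f i ≤ 1 :=
  (classAt_of_bookingLeaves Lv).2 Bk.K le_rfl i hi b hb

/-- **THE SOURCE WINDOW IS NON-EMPTY IFF THE NUMBER HOLDS** [arith]: for `m·N₀·a₁ > 0` and `ρ′ < 1`,
`0 < muWindow s̄⁰ ρ′ m N₀ a₁ ↔ s̄⁰ < 1`. -/
theorem muWindow_pos_iff {sbar ρ' m N₀ a₁ : ℝ} (hpos : 0 < m * N₀ * a₁) (hρ' : ρ' < 1) :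
    0 < muWindow sbar ρ' m N₀ a₁ ↔ sbar < 1 := by
  have h1 : 0 < 1 - ρ' := by linarith
  unfold muWindow
  rw [div_pos_iff_of_pos_right hpos]
  constructor
  · intro h
    by_contra hs
    have hs' : 1 ≤ sbar := not_lt.mp hs
    have : (1 - sbar) * (1 - ρ') ≤ 0 := mul_nonpos_of_nonpos_of_nonneg (by linarith) h1.le
    linarith
  · intro hs
    exact mul_pos (by linarith) h1

/-- **CONVERSE OF S3's `hsmall_of_le_muWindow`** [arith]: (w6) with `A₀ = a₁·μ₀` forces `μ₀ ≤ muWindow s̄⁰ ρ′ m N₀ a₁`. -/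
theorem le_muWindow_of_hsmall {sbar ρ' m N₀ a₁ μ₀ : ℝ} (hpos : 0 < m * N₀ * a₁) (hρ' : ρ' < 1)
    (h : m * (N₀ * (a₁ * μ₀) * (1 - ρ')⁻¹) ≤ 1 - sbar) : μ₀ ≤ muWindow sbar ρ' m N₀ a₁ := by
  have h1 : 0 < 1 - ρ' := by linarith
  have hre : m * (N₀ * (a₁ * μ₀) * (1 - ρ')⁻¹) = m * N₀ * a₁ * μ₀ / (1 - ρ') := by
    rw [div_eq_mul_inv]; ring
  rw [hre, div_le_iff₀ h1] at h
  unfold muWindow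
  rw [le_div_iff₀ hpos]
  linarith

/-- **THE WINDOW IS EXACT** [arith]: (w6) with `A₀ = a₁·μ₀` ⟺ `μ₀ ≤ muWindow s̄⁰ ρ′ m N₀ a₁` (for `m·N₀·a₁ > 0`, `ρ′ < 1`). -/
theorem hsmall_iff_le_muWindow {sbar ρ' m N₀ a₁ μ₀ : ℝ} (hpos : 0 < m * N₀ * a₁) (hρ' : ρ' < 1) :
    m * (N₀ * (a₁ * μ₀) * (1 - ρ')⁻¹) ≤ 1 - sbar ↔ μ₀ ≤ muWindow sbar ρ' m N₀ a₁ :=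
  ⟨le_muWindow_of_hsmall hpos hρ', hsmall_of_le_muWindow hpos hρ'⟩

/-- **THE SOURCE FACTOR IS CAPPED** [arith]: for every `U : UniformConstants` with `U.N₀·U.A₀ > 0`,
`U.m ≤ (1 − U.sbar)(1 − U.ρ′)∕(U.N₀·U.A₀)` — the dressed budget admits only a bounded source strength. -/
theorem m_le_of_uniformConstants (U : UniformConstants) (h : 0 < U.N₀ * U.A₀) :
    U.m ≤ (1 - U.sbar) * (1 - U.ρ') / (U.N₀ * U.A₀) := by
  have h1 : 0 < 1 - U.ρ' := by linarith [U.hρ'1]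
  have hs := U.hsmall
  have hre : U.m * (U.N₀ * U.A₀ * (1 - U.ρ')⁻¹) = U.m * (U.N₀ * U.A₀) / (1 - U.ρ') := by
    rw [div_eq_mul_inv]; ring
  rw [hre, div_le_iff₀ h1] at hs
  rw [le_div_iff₀ h]
  linarith

end Summit.QuantumFields.BalabanUV.T4Continuum.NE1p.DressedCellNecessity

end
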